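import Mathlib

/-!
# Small-hopping diamagnetism (stmt-QuantumFields-9738): spectral bookkeeping for complex matrices

Helper file for the support item `SmallHoppingDiamagnetism` of route `QuarksAsStableAction`.
For a square complex matrix `A` with characteristic roots `Λ = A.charpoly.roots` (a multiset of
cardinality `card n`, counted with algebraic multiplicity):

* `trace_pow_eq_sum_roots_pow` : `tr (A ^ k) = Σ_{λ ∈ Λ} λ ^ k` (generalized-eigenspace
  decomposition; on each generalized eigenspace `A = λ + nilpotent`);
* `det_one_sub_smul_eq_prod_roots` : `det (1 - t • A) = Π_{λ ∈ Λ} (1 - t λ)`;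
* `exists_eigenvector_of_mem_roots` : every `λ ∈ Λ` has an eigenvector `A v = λ v`, `v ≠ 0`
  (and `card Λ = card n`, inlined where used).

Mathlib only (no named facts).
-/

namespace Summit.QuantumFields.QCD.Theorems.SmallHopping

open Polynomial Module

section TracePow

variable {K V : Type*} [Field K] [AddCommGroup V] [Module K V] [FiniteDimensional K V]

/-- On the maximal generalized `μ`-eigenspace `W` of `f`, the restriction `g = f|_W` satisfies
`tr (g ^ k) = μ ^ k · dim W` (because `g - μ` is nilpotent). -/
theorem trace_restrict_maxGenEigenspace_pow (f : End K V) (μ : K)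
    (h : Set.MapsTo f (f.maxGenEigenspace μ) (f.maxGenEigenspace μ)) (k : ℕ) :
    LinearMap.trace K _ ((f.restrict h) ^ k) =
      μ ^ k * (finrank K (f.maxGenEigenspace μ) : K) := by
  have hnil : IsNilpotent (f.restrict h - algebraMap K _ μ) := by
    have h1 := f.isNilpotent_restrict_maxGenEigenspace_sub_algebraMap μ
    have h2 : f.restrict h - algebraMap K _ μ =
        (f - algebraMap K (End K V) μ).restrict
          (f.mapsTo_maxGenEigenspace_of_comm
            ((Commute.refl f).sub_right (Algebra.commute_algebraMap_right μ f)) μ) := by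
      ext ⟨x, hx⟩
      simp [LinearMap.restrict_apply, Algebra.algebraMap_eq_smul_one]
    rw [h2]
    exact h1
  induction k with
  | zero =>
    rw [pow_zero, pow_zero, one_mul, LinearMap.trace_one]
  | succ k ih =>
    rw [pow_succ, Module.End.mul_eq_comp,
      LinearMap.trace_comp_eq_mul_of_commute_of_isNilpotent μ ((Commute.refl _).pow_left k) hnil,
      ih, pow_succ]
    ring

/-- **Traces of powers are power sums of the characteristic roots** (endomorphism form): over an
algebraically closed field, `tr (f ^ k) = Σ_{λ} λ ^ k`, the sum running over the roots of the
characteristic polynomial with multiplicity. -/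
theorem LinearMap.trace_pow_eq_sum_roots_pow [IsAlgClosed K] (f : End K V) (k : ℕ) :
    LinearMap.trace K V (f ^ k) = (f.charpoly.roots.map (· ^ k)).sum := by
  classical
  have hind := f.independent_maxGenEigenspace
  have hds := DirectSum.isInternal_submodule_of_iSupIndep_of_iSup_eq_top hind
    f.iSup_maxGenEigenspace_eq_top
  have hfin : {μ | f.maxGenEigenspace μ ≠ ⊥}.Finite :=
    WellFoundedGT.finite_ne_bot_of_iSupIndep hind
  have hmaps1 : ∀ μ, Set.MapsTo f (f.maxGenEigenspace μ) (f.maxGenEigenspace μ) := fun μ =>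
    f.mapsTo_maxGenEigenspace_of_comm (Commute.refl f) μ
  have hmaps : ∀ μ, Set.MapsTo (f ^ k) (f.maxGenEigenspace μ) (f.maxGenEigenspace μ) := fun μ =>
    f.mapsTo_maxGenEigenspace_of_comm ((Commute.refl f).pow_right k) μ
  rw [LinearMap.trace_eq_sum_trace_restrict' hds hfin hmaps]
  have hterm : ∀ μ, LinearMap.trace K _ ((f ^ k).restrict (hmaps μ)) =
      μ ^ k * (f.charpoly.rootMultiplicity μ : K) := by
    intro μ
    rw [← LinearMap.finrank_maxGenEigenspace_eq, ← Module.End.pow_restrict k (hmaps1 μ)]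
    exact trace_restrict_maxGenEigenspace_pow f μ (hmaps1 μ) k
  simp_rw [hterm]
  rw [Finset.sum_multiset_map_count]
  simp_rw [Polynomial.count_roots, nsmul_eq_mul, mul_comm (_ : K) (_ ^ k)]
  symm
  refine Finset.sum_subset ?_ ?_
  · intro μ hμ
    rw [Multiset.mem_toFinset, Polynomial.mem_roots (LinearMap.charpoly_monic f).ne_zero] at hμ
    rw [Set.Finite.mem_toFinset, Set.mem_setOf_eq]
    intro hbot
    have h0 : finrank K (f.maxGenEigenspace μ) = 0 := by rw [hbot, finrank_bot]
    rw [LinearMap.finrank_maxGenEigenspace_eq] at h0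
    exact ((Polynomial.rootMultiplicity_pos (LinearMap.charpoly_monic f).ne_zero).mpr hμ).ne' h0
  · intro μ _ hμ
    rw [Multiset.mem_toFinset, Polynomial.mem_roots (LinearMap.charpoly_monic f).ne_zero] at hμ
    rw [Polynomial.rootMultiplicity_eq_zero hμ, Nat.cast_zero, mul_zero]

end TracePow

section Matrix

variable {n : Type*} [Fintype n] [DecidableEq n]

/-- **Traces of powers are power sums of the characteristic roots** (matrix form):
`tr (A ^ k) = Σ_{λ ∈ roots(χ_A)} λ ^ k` for a complex square matrix `A`. -/
theorem trace_pow_eq_sum_roots_pow (A : Matrix n n ℂ) (k : ℕ) :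
    (A ^ k).trace = (A.charpoly.roots.map (· ^ k)).sum := by
  have h := LinearMap.trace_pow_eq_sum_roots_pow (Matrix.toLin' A) k
  rw [Matrix.charpoly_toLin', ← Matrix.toLin'_pow,
    LinearMap.trace_eq_matrix_trace ℂ (Pi.basisFun ℂ n), LinearMap.toMatrix_eq_toMatrix',
    LinearMap.toMatrix'_toLin'] at h
  exact h

/-- `det (1 - t • A) = Π_{λ ∈ roots(χ_A)} (1 - t λ)` for a complex square matrix `A`. -/
theorem det_one_sub_smul_eq_prod_roots (A : Matrix n n ℂ) (t : ℂ) :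
    (1 - t • A).det = (A.charpoly.roots.map (fun z => 1 - t * z)).prod := by
  have hcard : Multiset.card A.charpoly.roots = Fintype.card n := by
    rw [← (IsAlgClosed.splits A.charpoly).natDegree_eq_card_roots, Matrix.charpoly_natDegree_eq_dim]
  rcases eq_or_ne t 0 with rfl | ht
  · simp
  · have h1 : (1 : Matrix n n ℂ) - t • A = t • (Matrix.scalar n t⁻¹ - A) := by
      rw [smul_sub, Matrix.scalar_apply, ← Matrix.diagonal_smul, ← Matrix.diagonal_one]
      congr 1
      ext i j
      by_cases hij : i = j
      · subst hij; simp [ht]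
      · simp [Matrix.diagonal_apply_ne _ hij]
    rw [h1, Matrix.det_smul, ← Matrix.eval_charpoly,
      (IsAlgClosed.splits A.charpoly).eval_eq_prod_roots_of_monic (Matrix.charpoly_monic A),
      ← hcard]
    rw [show (t ^ Multiset.card A.charpoly.roots : ℂ) =
        (A.charpoly.roots.map (fun _ => t)).prod by
      rw [Multiset.map_const', Multiset.prod_replicate]]
    rw [← Multiset.prod_map_mul]
    congr 1
    refine Multiset.map_congr rfl fun z _ => ?_
    field_simp

/-- Every characteristic root of a complex square matrix is an eigenvalue: it has a nonzero
eigenvector. -/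
theorem exists_eigenvector_of_mem_roots (A : Matrix n n ℂ) {z : ℂ} (hz : z ∈ A.charpoly.roots) :
    ∃ v : n → ℂ, v ≠ 0 ∧ A.mulVec v = z • v := by
  rw [Polynomial.mem_roots (Matrix.charpoly_monic A).ne_zero, ← Matrix.charpoly_toLin',
    ← Module.End.hasEigenvalue_iff_isRoot_charpoly] at hz
  obtain ⟨v, hv⟩ := hz.exists_hasEigenvector
  exact ⟨v, hv.2, by simpa [Matrix.toLin'_apply] using hv.apply_eq_smul⟩

/-- If every eigenvector relation `A v = z v`, `v ≠ 0`, forces `‖z‖ ≤ R`, then every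
characteristic root has modulus at most `R`. -/
theorem norm_le_of_mem_roots (A : Matrix n n ℂ) {R : ℝ}
    (hR : ∀ (z : ℂ) (v : n → ℂ), v ≠ 0 → A.mulVec v = z • v → ‖z‖ ≤ R)
    {z : ℂ} (hz : z ∈ A.charpoly.roots) : ‖z‖ ≤ R := by
  obtain ⟨v, hv, hAv⟩ := exists_eigenvector_of_mem_roots A hz
  exact hR z v hv hAv

/-- With all characteristic roots of modulus `≤ R`, the traces of powers obey
`‖tr (A ^ k)‖ ≤ card n · R ^ k`. -/
theorem norm_trace_pow_le (A : Matrix n n ℂ) {R : ℝ}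
    (hR : ∀ z ∈ A.charpoly.roots, ‖z‖ ≤ R) (k : ℕ) :
    ‖(A ^ k).trace‖ ≤ Fintype.card n * R ^ k := by
  have hcard : Multiset.card A.charpoly.roots = Fintype.card n := by
    rw [← (IsAlgClosed.splits A.charpoly).natDegree_eq_card_roots, Matrix.charpoly_natDegree_eq_dim]
  rw [trace_pow_eq_sum_roots_pow, ← hcard]
  refine (norm_multiset_sum_le _).trans ?_
  rw [Multiset.map_map]
  calc (A.charpoly.roots.map (Function.comp norm fun x => x ^ k)).sum
      ≤ (A.charpoly.roots.map fun _ => R ^ k).sum :=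
        Multiset.sum_map_le_sum_map _ _ fun z hz => by
          simp only [Function.comp_apply, norm_pow]
          exact pow_le_pow_left₀ (norm_nonneg _) (hR z hz) k
    _ = Multiset.card A.charpoly.roots * R ^ k := by
        rw [Multiset.map_const', Multiset.sum_replicate, nsmul_eq_mul]

end Matrix

end Summit.QuantumFields.QCD.Theorems.SmallHopping
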